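import Summits.NavierStokesRegularity.NavierStokesRegularity.Theorems.TypeIliouvilleNoTypeII.Negative.NSITypeIIBlowupHolds
import Summits.NavierStokesRegularity.NavierStokesRegularity.Theorems.TypeIliouvilleNoTypeII.Negative.NSIBlockStrictGain
import HarnessLib

/-!
# The NSI super-cascade carries no energy atom: its energy tends to zero at the blow-up time

Negative-lane support for `Summit.NavierStokesRegularity.NavierStokesRegularity.Theses.TypeILiouville.TypeIliouvilleNoTypeII`
(item `stmt-NavierStokesRegularity-0056`), sequel to `NSIBlockStrictGain` (the energy cap of the
NSI super-similar class is strict, `IsSuperBlock.cap_lt_one : a²τ³ < 1`). It answers — inside the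
tree's NSI Type-II family (`IsSuperBlock` / `glueG`, the witness of `NSITypeIIBlowup_holds`) —
the question filed with the barrier `Literature.Barriers.NavierStokesRegularity.NSITypeIIBlowup`
(«does the NSI cascade carry an energy atom at its blow-up time?», K-READ 05 §6): **no.**

Main results (namespace `…Theorems.TypeIliouvilleNoTypeIINegative`):

* `nsiBlock_energy_le_of_mem` — the energy inequality of an NSI block on `[0,s]` for every
  intermediate time `s ∈ [0,T]` and every `ν ∈ [0,ν₀]`:
  `∫|u(s)|² − ∫|u(0)|² + 2ν∫₀ˢ∫|∇u|² ≤ 0` (`nsiBlock_energy_le` is the case `s = T`); hence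
  **energy monotonicity** `∫|u(s)|² ≤ ∫|u(0)|²` (`nsiBlock_integral_norm_sq_le`,
  `nsiBlock_lintegral_norm_sq_le`; at `ν = 0`, no dissipation used).
* `isSuperBlock_of_gain` — the field `cap : a²τ³ ≤ 1` of `IsSuperBlock` is REDUNDANT.
* `IsSuperBlock.lintegral_norm_sq_glueG_eq` / `…_le` / `…_le_of_le` — on the `j`-th piece the
  energy of the glued field is EXACTLY `(a²τ³)ʲ ∫|u(s_j(t))|² ≤ (a²τ³)ʲ ∫|u(0)|²`, and uniformly
  `≤ (a²τ³)ᴶ ∫|u(0)|²` past the `J`-th switching time.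
* `IsSuperBlock.tendsto_lintegral_norm_sq_glueG` — **the energy of the super-cascade tends to `0`
  at its blow-up time** (two-sided limit; the field is `0` from `T₀` on) and is continuous there
  (`continuousAt_lintegral_norm_sq_glueG`): NO ENERGY ATOM — in contrast with the downward jumps
  at the switching times (`IsNSIBlock.not_continuousWithinAt_energy_glue`). In the shape of the
  conclusion of the registered stub `Cruxes/WeakLambdaCriterion/Lines/birth.lean :: stub_noEnergyAtom`:
  `IsSuperBlock.noEnergyAtom_glueG` (every centre; any radius works).
* `nsiTypeIIBlowup_noEnergyAtom` — the barrier statement `NSITypeIIBlowup` STRENGTHENED by the two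
  no-atom clauses (energy `→ 0` at `T₀`; stub-shaped clause at every centre), with the same kind
  of witness as `NSITypeIIBlowup_holds` (amplitude simply `a = g`, the cap being automatic).

What this is NOT: not a statement about the Navier–Stokes equations, and not the stub
`stub_noEnergyAtom` (whose hypothesis class — classical NS solution, Leray–Hopf from a decaying
datum — the NSI cascade does not meet). It says that the model class M2′ behind `NSITypeIIBlowup`
is NOT a counter-model to energy non-concentration statements: a drop-switching cascade keeps
exactly the fraction `a²τ³ < 1` of its energy per generation, so its energy at the singular time
is zero. An NSI field WITH an energy atom would need a different block format (support
contracting onto `Γ(G)` at time `T`, gain exactly `τ^{-3/2}`, no drop loss) — neither excluded nor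
constructed here. [folklore] (the `a = τ⁻¹` bookkeeping `‖𝔲(t)‖ ≤ τ^{j/2} sup ‖u‖` is
[cite: Ozanski2017NSISingular, §2 (2.6) and §2.1 p. 7]).
-/

noncomputable section

open MeasureTheory Set Function Filter Topology TopologicalSpace Metric Module
open scoped ENNReal NNReal InnerProductSpace RealInnerProductSpace ContDiff Laplacian

set_option linter.dupNamespace false

namespace Summit.NavierStokesRegularity.NavierStokesRegularity.Theorems.TypeIliouvilleNoTypeIINegative

open Literature.Analysis.FluidPDE Literature.Barriers.NavierStokesRegularity
open Literature.Barriers.NavierStokesRegularity.Scheffer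

/-! ### Energy monotonicity of an NSI block at intermediate times -/

section Block

variable {T ν₀ τ : ℝ} {z : EuclideanSpace ℝ (Fin 3)} {G : Set (EuclideanSpace ℝ (Fin 3))}
  {u : ℝ → EuclideanSpace ℝ (Fin 3) → EuclideanSpace ℝ (Fin 3)}

/-- **The energy inequality of an NSI block on `[0,s]`, `s ∈ [0,T]`**: for every `ν ∈ [0, ν₀]`,
`∫|u(s)|² − ∫|u(0)|² + 2ν ∫₀ˢ∫|∇u|² ≤ 0` — the local energy inequality with boundary terms
(`nsi_localEnergyIneq_Icc`) on `[0,s]`, tested against the plateau `θ ≡ 1` near `[0,T] × G` of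
`exists_spaceTime_plateau`: every right-hand term carries a derivative of `θ` on the support and
vanishes. The case `s = T` is `nsiBlock_energy_le`. [cite: Ozanski2017NSISingular, §1 (1.5) and §2.1 p. 7] -/
theorem nsiBlock_energy_le_of_mem (h : IsNSIBlock T ν₀ τ z G u) {ν : ℝ} (hν : ν ∈ Icc 0 ν₀)
    {s : ℝ} (hs : s ∈ Icc 0 T) :
    (∫ x, ‖u s x‖ ^ 2) - (∫ x, ‖u 0 x‖ ^ 2) +
        2 * ν * ∫ t in Ioo 0 s, ∫ x, frobeniusNormSq (fderiv ℝ (u t) x) ≤ 0 := by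
  obtain ⟨θ, hθ, hθ0, hθ1⟩ :=
    exists_spaceTime_plateau (isCompact_Icc.prod h.isCompact : IsCompact (Icc (0 : ℝ) T ×ˢ G))
  obtain ⟨η, hη, hsm⟩ := h.smooth
  have hsub : Icc 0 s ⊆ Icc 0 T := Icc_subset_Icc_right hs.2
  have hIoo : Ioo 0 s ⊆ Icc 0 T := fun t ht => ⟨ht.1.le, ht.2.le.trans hs.2⟩
  have hIS : Icc 0 s ⊆ Ioo (-η) (T + η) := fun t ht => ⟨by linarith [ht.1], by linarith [ht.2, hs.2]⟩
  -- the local energy inequality on `[0, s]`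
  have key := nsi_localEnergyIneq_Icc (p := fun t => normalisedPressure (u t)) hs.1 isOpen_Ioo hIS
    hsm h.isCompact (fun t ht x hx => h.apply_eq_zero_of_notMem (hsub ht) hx)
    (fun t ht => h.divFree t (hsub ht))
    (fun t ht => (contDiff_normalisedPressure_of_hasCompactSupport (h.contDiff_slice (hsub ht))
      (h.hasCompactSupport_slice (hsub ht))).of_le one_le_two)
    (h.continuousOn_normalisedPressure.mono (prod_mono hsub Subset.rfl))
    (fun t ht x => h.nsi ν hν t (hsub ht) x) hθ hθ0
  -- consequences of the plateau on `[0,T] × G`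
  have hpl : ∀ t ∈ Icc (0 : ℝ) T, ∀ x ∈ G,
      θ t x = 1 ∧ timeDeriv θ t x = 0 ∧ gradient (θ t) x = 0 ∧ Δ (θ t) x = 0 :=
    fun t ht x hx => plateau_derivs (hθ1 (t, x) ⟨ht, hx⟩)
  -- boundary terms
  have hbd : ∀ t ∈ Icc (0 : ℝ) T, (∫ x, ‖u t x‖ ^ 2 * θ t x) = ∫ x, ‖u t x‖ ^ 2 := by
    intro t ht
    refine integral_congr_ae (Eventually.of_forall fun x => ?_)
    beta_reduce
    by_cases hx : x ∈ G
    · rw [(hpl t ht x hx).1, mul_one]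
    · simp [h.apply_eq_zero_of_notMem ht hx]
  -- dissipation term
  have hds : (∫ t in Ioo 0 s, ∫ x, frobeniusNormSq (fderiv ℝ (u t) x) * θ t x) =
      ∫ t in Ioo 0 s, ∫ x, frobeniusNormSq (fderiv ℝ (u t) x) := by
    refine setIntegral_congr_fun measurableSet_Ioo fun t ht => ?_
    refine integral_congr_ae (Eventually.of_forall fun x => ?_)
    beta_reduce
    by_cases hx : x ∈ G
    · rw [(hpl t (hIoo ht) x hx).1, mul_one]
    · rw [h.fderiv_slice_eq_zero_of_notMem (hIoo ht) hx, frobeniusNormSq_zero, zero_mul]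
  -- the right-hand side vanishes identically
  have hrhs : (∫ t in Ioo 0 s, ∫ x, (‖u t x‖ ^ 2 * (timeDeriv θ t x + ν * Δ (θ t) x) +
      (‖u t x‖ ^ 2 + 2 * normalisedPressure (u t) x) * ⟪u t x, gradient (θ t) x⟫)) = 0 := by
    have hz : EqOn (fun t => ∫ x, (‖u t x‖ ^ 2 * (timeDeriv θ t x + ν * Δ (θ t) x) +
        (‖u t x‖ ^ 2 + 2 * normalisedPressure (u t) x) * ⟪u t x, gradient (θ t) x⟫))
        (fun _ => (0 : ℝ)) (Ioo 0 s) := by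
      intro t ht
      refine (integral_congr_ae (Eventually.of_forall fun x => ?_)).trans (integral_zero _ _)
      beta_reduce
      by_cases hx : x ∈ G
      · obtain ⟨-, h1, h2, h3⟩ := hpl t (hIoo ht) x hx
        rw [h1, h2, h3, inner_zero_right]
        ring
      · rw [h.apply_eq_zero_of_notMem (hIoo ht) hx, norm_zero, inner_zero_left]
        ring
    rw [setIntegral_congr_fun measurableSet_Ioo hz, integral_zero]
  rw [hbd s hs, hbd 0 ⟨le_rfl, h.T_pos.le⟩, hds, hrhs] at key
  exact key

/-- **The energy of an NSI block does not increase**: `∫|u(s)|² ≤ ∫|u(0)|²` for `s ∈ [0,T]`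
(`nsiBlock_energy_le_of_mem` at `ν = 0`: no dissipation is needed). [cite: Ozanski2017NSISingular, §2.1 p. 7] -/
theorem nsiBlock_integral_norm_sq_le (h : IsNSIBlock T ν₀ τ z G u) {s : ℝ} (hs : s ∈ Icc 0 T) :
    ∫ x, ‖u s x‖ ^ 2 ≤ ∫ x, ‖u 0 x‖ ^ 2 := by
  have key := nsiBlock_energy_le_of_mem h ⟨le_rfl, h.ν₀_pos.le⟩ hs
  linarith

/-- `∫⁻ |u(t)|² = ofReal (∫ |u(t)|²)` for the continuous, compactly supported slices `u(t)`,
`t ∈ [0,T]`. [folklore] -/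
theorem nsiBlock_lintegral_enorm_sq_eq (h : IsNSIBlock T ν₀ τ z G u) {t : ℝ} (ht : t ∈ Icc 0 T) :
    ∫⁻ x, ‖u t x‖ₑ ^ 2 = ENNReal.ofReal (∫ x, ‖u t x‖ ^ 2) := by
  rw [ofReal_integral_eq_lintegral_ofReal
    (integrable_norm_sq_of_hasCompactSupport (h.contDiff_slice ht).continuous
      (h.hasCompactSupport_slice ht)) (Eventually.of_forall fun x => sq_nonneg _)]
  refine lintegral_congr fun x => ?_
  rw [← ofReal_norm, ← ENNReal.ofReal_pow (norm_nonneg _)]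

/-- **Energy monotonicity of an NSI block** (as extended integrals): `∫⁻|u(s)|² ≤ ∫⁻|u(0)|²` for
`s ∈ [0,T]`. [cite: Ozanski2017NSISingular, §2.1 p. 7] -/
theorem nsiBlock_lintegral_norm_sq_le (h : IsNSIBlock T ν₀ τ z G u) {s : ℝ} (hs : s ∈ Icc 0 T) :
    ∫⁻ x, ‖u s x‖ₑ ^ 2 ≤ ∫⁻ x, ‖u 0 x‖ₑ ^ 2 := by
  rw [nsiBlock_lintegral_enorm_sq_eq h hs, nsiBlock_lintegral_enorm_sq_eq h ⟨le_rfl, h.T_pos.le⟩]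
  exact ENNReal.ofReal_le_ofReal (nsiBlock_integral_norm_sq_le h hs)

/-! ### The energy cap of `IsSuperBlock` is automatic -/

/-- **`IsSuperBlock` without its `cap` field**: the energy cap `a²τ³ ≤ 1` of a super-similar
cascade datum is automatic from the gain (`nsiBlock_gain_sq_mul_cube_lt_one` of
`NSIBlockStrictGain`, which even gives `a²τ³ < 1`). [folklore] -/
theorem isSuperBlock_of_gain {σ a : ℝ} (hblock : IsNSIBlock T ν₀ τ z G u) (hσ : 0 < σ)
    (hcov : a * σ ^ 2 = τ) (hinv : τ⁻¹ < a) (hgain : ∀ y, a * ‖u 0 y‖ ≤ ‖u T (τ • y + z)‖) :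
    IsSuperBlock T ν₀ τ σ a z G u :=
  ⟨hblock, hσ, hcov, hinv,
    (nsiBlock_gain_sq_mul_cube_lt_one hblock ((inv_pos.2 hblock.τ_pos).trans hinv).le hgain).le, hgain⟩

end Block

/-! ### The energy of the super-cascade tends to zero at the blow-up time -/

namespace IsSuperBlock

variable {T ν₀ τ σ a : ℝ} {z : EuclideanSpace ℝ (Fin 3)} {G : Set (EuclideanSpace ℝ (Fin 3))}
  {u : ℝ → EuclideanSpace ℝ (Fin 3) → EuclideanSpace ℝ (Fin 3)}

/-- `0 ≤ a²τ³`. [folklore] -/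
theorem energyRatio_nonneg (h : IsSuperBlock T ν₀ τ σ a z G u) : 0 ≤ a ^ 2 * τ ^ 3 :=
  mul_nonneg (sq_nonneg a) (pow_nonneg h.τ_pos.le 3)

/-- **Energy of the glued field on the `j`-th piece**: `∫|𝔲(t)|² = (a²τ³)ʲ ∫|u(s_j(t))|²` with
`s_j(t) = σ^{-2j}(t - t_j)` (`u^{(j)}(t) = aʲ u(s_j(t), Γ^{-j}·)`, `|det Γ^{-j}| = τ^{-3j}`).
[cite: Ozanski2017NSISingular, §2 p. 7] -/
theorem lintegral_norm_sq_glueG_eq (h : IsSuperBlock T ν₀ τ σ a z G u) {t : ℝ} {j : ℕ}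
    (hj : t ∈ Ico (switchTime T σ j) (switchTime T σ (j + 1))) :
    ∫⁻ x, ‖glueG T σ τ a z u t x‖ₑ ^ 2 =
      ENNReal.ofReal ((a ^ 2 * τ ^ 3) ^ j) *
        ∫⁻ y, ‖u ((σ⁻¹) ^ (2 * j) * (t - switchTime T σ j)) y‖ₑ ^ 2 := by
  have hγ := h.inv_tau_pow_pos j
  have ha := h.gain_pow_pos j
  rw [glueG_eq_pieceG h.T_pos h.σ_pos τ a z u hj, pieceG_slice_eq_smul_comp_affine]
  have e : ∀ x : EuclideanSpace ℝ (Fin 3), ‖a ^ j •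
      u ((σ⁻¹) ^ (2 * j) * (t - switchTime T σ j)) ((1 - (τ⁻¹) ^ j) • (1 - τ)⁻¹ • z + (τ⁻¹) ^ j • x)‖ₑ ^ 2 =
      ENNReal.ofReal ((a ^ j) ^ 2) *
        ‖u ((σ⁻¹) ^ (2 * j) * (t - switchTime T σ j)) ((1 - (τ⁻¹) ^ j) • (1 - τ)⁻¹ • z + (τ⁻¹) ^ j • x)‖ₑ ^ 2 := by
    intro x
    simp only [enorm_smul, mul_pow, Real.enorm_eq_ofReal ha.le, ENNReal.ofReal_pow ha.le]
  rw [lintegral_congr e,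
    lintegral_comp_space_affine hγ ((1 - (τ⁻¹) ^ j) • (1 - τ)⁻¹ • z)
      (fun y => ENNReal.ofReal ((a ^ j) ^ 2) * ‖u ((σ⁻¹) ^ (2 * j) * (t - switchTime T σ j)) y‖ₑ ^ 2),
    lintegral_const_mul' _ _ ENNReal.ofReal_ne_top,
    ← mul_assoc, ← ENNReal.ofReal_mul (inv_pos.2 (pow_pos hγ _)).le, finrank_euclideanSpace_fin]
  have hcoef : (((τ⁻¹) ^ j) ^ 3)⁻¹ * (a ^ j) ^ 2 = (a ^ 2 * τ ^ 3) ^ j := by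
    rw [inv_pow, inv_pow, inv_inv]
    ring
  rw [hcoef]

/-- **Geometric energy decay along the cascade**: on the `j`-th piece
`∫|𝔲(t)|² ≤ (a²τ³)ʲ ∫|u(0)|²` (energy monotonicity of the block). [folklore] -/
theorem lintegral_norm_sq_glueG_le (h : IsSuperBlock T ν₀ τ σ a z G u) {t : ℝ} {j : ℕ}
    (hj : t ∈ Ico (switchTime T σ j) (switchTime T σ (j + 1))) :
    ∫⁻ x, ‖glueG T σ τ a z u t x‖ₑ ^ 2 ≤
      ENNReal.ofReal ((a ^ 2 * τ ^ 3) ^ j) * ∫⁻ y, ‖u 0 y‖ₑ ^ 2 := by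
  rw [h.lintegral_norm_sq_glueG_eq hj]
  have hs := h.localTime_mem (Ico_subset_Icc_self hj)
  have hs' : (σ⁻¹) ^ (2 * j) * (t - switchTime T σ j) ∈ Icc 0 T := by
    convert hs using 1; ring
  exact mul_le_mul_of_nonneg_left (nsiBlock_lintegral_norm_sq_le h.block hs') (by simp)

/-- **Uniform geometric decay past the `J`-th switching time**: `∫|𝔲(t)|² ≤ (a²τ³)ᴶ ∫|u(0)|²` for
every `t ≥ t_J` (on `[t_j, t_{j+1})` with `j ≥ J` the factor is `(a²τ³)ʲ ≤ (a²τ³)ᴶ`; from `T₀` on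
the field is zero). [folklore] -/
theorem lintegral_norm_sq_glueG_le_of_le (h : IsSuperBlock T ν₀ τ σ a z G u) {J : ℕ} {t : ℝ}
    (ht : switchTime T σ J ≤ t) :
    ∫⁻ x, ‖glueG T σ τ a z u t x‖ₑ ^ 2 ≤
      ENNReal.ofReal ((a ^ 2 * τ ^ 3) ^ J) * ∫⁻ y, ‖u 0 y‖ₑ ^ 2 := by
  by_cases ht' : t < blowupTime T σ
  · have h0 : 0 ≤ t := (switchTime_nonneg h.T_pos h.σ_pos J).trans ht
    obtain ⟨j, hj⟩ := exists_mem_Ico_switchTime h.σ_pos h.σ_lt_one h0 ht'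
    have hJj : J ≤ j :=
      Nat.lt_succ_iff.1 ((strictMono_switchTime h.T_pos h.σ_pos).lt_iff_lt.1 (ht.trans_lt hj.2))
    calc ∫⁻ x, ‖glueG T σ τ a z u t x‖ₑ ^ 2
        ≤ ENNReal.ofReal ((a ^ 2 * τ ^ 3) ^ j) * ∫⁻ y, ‖u 0 y‖ₑ ^ 2 := h.lintegral_norm_sq_glueG_le hj
      _ ≤ ENNReal.ofReal ((a ^ 2 * τ ^ 3) ^ J) * ∫⁻ y, ‖u 0 y‖ₑ ^ 2 :=
          mul_le_mul_of_nonneg_right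
            (ENNReal.ofReal_le_ofReal (pow_le_pow_of_le_one h.energyRatio_nonneg h.cap_lt_one.le hJj))
            (by simp)
  · rw [glueG_eq_zero_of_le h.T_pos h.σ_pos h.σ_lt_one τ a z u (not_lt.1 ht')]
    simp

/-- The energy vanishes from the blow-up time on. [folklore] -/
theorem lintegral_norm_sq_glueG_eq_zero_of_le (h : IsSuperBlock T ν₀ τ σ a z G u) {t : ℝ}
    (ht : blowupTime T σ ≤ t) : ∫⁻ x, ‖glueG T σ τ a z u t x‖ₑ ^ 2 = 0 := by
  rw [glueG_eq_zero_of_le h.T_pos h.σ_pos h.σ_lt_one τ a z u ht]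
  simp

/-- **The energy of the super-cascade tends to zero at its blow-up time — no energy atom**:
`∫|𝔲(t)|² ≤ (a²τ³)ᴶ ∫|u(0)|²` past `t_J ↑ T₀`, `a²τ³ < 1` (`cap_lt_one`) and `∫|u(0)|² < ∞`.
[folklore] -/
theorem tendsto_lintegral_norm_sq_glueG (h : IsSuperBlock T ν₀ τ σ a z G u) :
    Tendsto (fun t => ∫⁻ x, ‖glueG T σ τ a z u t x‖ₑ ^ 2) (𝓝 (blowupTime T σ)) (𝓝 0) := by
  have h0 : (0 : ℝ) ∈ Icc 0 T := ⟨le_rfl, h.T_pos.le⟩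
  obtain ⟨C, hC, hE⟩ := h.block.exists_energy_bound
  have hfin : ∫⁻ y, ‖u 0 y‖ₑ ^ 2 ≠ ⊤ := ((hE 0 h0).trans_lt hC).ne
  have hq : Tendsto (fun J : ℕ => ENNReal.ofReal ((a ^ 2 * τ ^ 3) ^ J) * ∫⁻ y, ‖u 0 y‖ₑ ^ 2)
      atTop (𝓝 0) := by
    have h1 := ENNReal.tendsto_ofReal
      (tendsto_pow_atTop_nhds_zero_of_lt_one h.energyRatio_nonneg h.cap_lt_one)
    rw [ENNReal.ofReal_zero] at h1
    simpa using ENNReal.Tendsto.mul_const h1 (Or.inr hfin)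
  rw [ENNReal.tendsto_nhds_zero]
  intro ε hε
  obtain ⟨J, hJ⟩ := (ENNReal.tendsto_nhds_zero.1 hq ε hε).exists
  filter_upwards [Ioi_mem_nhds (switchTime_lt_blowupTime h.T_pos h.σ_pos h.σ_lt_one J)] with t ht
  exact (h.lintegral_norm_sq_glueG_le_of_le (le_of_lt ht)).trans hJ

/-- **The energy `t ↦ ∫|𝔲(t)|²` is continuous at the blow-up time** (value `0` there): the energy
measures `|𝔲(t)|² dx` converge to the zero measure as `t → T₀` — no atom, no concentration of any
kind at the singular time, in contrast with the downward JUMPS at the switching times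
(`IsNSIBlock.not_continuousWithinAt_energy_glue`). [folklore] -/
theorem continuousAt_lintegral_norm_sq_glueG (h : IsSuperBlock T ν₀ τ σ a z G u) :
    ContinuousAt (fun t => ∫⁻ x, ‖glueG T σ τ a z u t x‖ₑ ^ 2) (blowupTime T σ) := by
  rw [ContinuousAt, h.lintegral_norm_sq_glueG_eq_zero_of_le le_rfl]
  exact h.tendsto_lintegral_norm_sq_glueG

/-- **No energy atom, in the shape of the conclusion of the registered stub `stub_noEnergyAtom`**
(at the cascade's blow-up time, for every centre — any radius works): for every `x₀` and `η > 0`,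
eventually as `t ↑ T₀`, `∫_{B_r(x₀)} |𝔲(t)|² < η`. [folklore] -/
theorem noEnergyAtom_glueG (h : IsSuperBlock T ν₀ τ σ a z G u) (x₀ : EuclideanSpace ℝ (Fin 3))
    (η : ℝ≥0) (hη : 0 < η) :
    ∃ r : ℝ, 0 < r ∧ ∀ᶠ t in 𝓝[<] blowupTime T σ,
      ∫⁻ x in Metric.ball x₀ r, ‖glueG T σ τ a z u t x‖ₑ ^ 2 < (η : ℝ≥0∞) := by
  refine ⟨1, one_pos, ?_⟩
  have hη' : (0 : ℝ≥0∞) < η := by exact_mod_cast hη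
  have hev := h.tendsto_lintegral_norm_sq_glueG.eventually (gt_mem_nhds hη')
  filter_upwards [hev.filter_mono nhdsWithin_le_nhds] with t ht
  exact (setLIntegral_le_lintegral _ _).trans_lt ht

end IsSuperBlock

/-! ### The barrier statement with the no-atom clauses -/

/-- **`NSITypeIIBlowup` with no energy atom.** The barrier statement
`Literature.Barriers.NavierStokesRegularity.NSITypeIIBlowup` (one compactly supported, spatially
smooth weak NSI solution for all `ν ∈ [0, ν₀]`, bounded before `T₀`, singular at `(T₀, x₀)`, with
the non-Type-I rate `sup_x |u(t,x)| ≥ c (T₀ - t)^{-β}`, `β > 1/2`) holds with a witness whose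
ENERGY TENDS TO ZERO at `T₀` and which satisfies the `stub_noEnergyAtom`-shaped no-atom clause at
every centre: the NSI Type-II family is not a counter-model to energy non-concentration. Witness:
the super-similar cascade of B1's super-gain block (`exists_superGain_nsiBlock`) with amplitude
`a = g` itself (the energy cap being automatic, `isSuperBlock_of_gain`) and clock `σ = √(τ/g)`.
[folklore] -/
theorem nsiTypeIIBlowup_noEnergyAtom :
    ∃ ν₀ : ℝ, 0 < ν₀ ∧
      ∃ (K : Set (EuclideanSpace ℝ (Fin 3))) (u : ℝ → EuclideanSpace ℝ (Fin 3) → EuclideanSpace ℝ (Fin 3))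
        (p : ℝ → EuclideanSpace ℝ (Fin 3) → ℝ),
        IsCompact K ∧ (∀ ν ∈ Icc (0 : ℝ) ν₀, IsWeakNSISolution ν u p) ∧
        (∀ t : ℝ, 0 ≤ t → ContDiff ℝ (⊤ : ℕ∞) (u t) ∧ tsupport (u t) ⊆ K) ∧
        ∃ (T₀ : ℝ) (x₀ : EuclideanSpace ℝ (Fin 3)), 0 < T₀ ∧
          ¬ IsRegularPoint u (T₀, x₀) ∧
          (∀ T' : ℝ, T' < T₀ → ∃ M : ℝ, ∀ t ∈ Icc 0 T', ∀ x, ‖u t x‖ ≤ M) ∧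
          (∃ β c : ℝ, 1 / 2 < β ∧ 0 < c ∧
            ∀ t ∈ Ico 0 T₀, ∃ x, c * (T₀ - t) ^ (-β) ≤ ‖u t x‖) ∧
          Tendsto (fun t => ∫⁻ x, ‖u t x‖ₑ ^ 2) (𝓝 T₀) (𝓝 0) ∧
          ∀ (x₁ : EuclideanSpace ℝ (Fin 3)) (η : ℝ≥0), 0 < η →
            ∃ r : ℝ, 0 < r ∧
              ∀ᶠ t in 𝓝[<] T₀, ∫⁻ x in Metric.ball x₁ r, ‖u t x‖ₑ ^ 2 < (η : ℝ≥0∞) := by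
  obtain ⟨T, ν₀, τ, z, G, u, g, hblock, hg, hgain⟩ := exists_superGain_nsiBlock
  obtain ⟨hσ₀, hσ₁, hcov, haσ, -⟩ := superCascade_params hblock.τ_pos hblock.τ_lt_one hg
  have hS : IsSuperBlock T ν₀ τ (Real.sqrt (τ / g)) g z G u :=
    isSuperBlock_of_gain hblock hσ₀ hcov hg hgain
  have hT₀ : 0 < blowupTime T (Real.sqrt (τ / g)) :=
    div_pos hblock.T_pos (by nlinarith [hS.σ_sq_lt_one])
  exact ⟨ν₀, hblock.ν₀_pos, G, glueG T (Real.sqrt (τ / g)) τ g z u,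
    fun t => normalisedPressure (glueG T (Real.sqrt (τ / g)) τ g z u t), hblock.isCompact,
    fun ν hν => hS.isWeakNSISolution_glueG hν,
    fun t _ => ⟨hS.contDiff_glueG_slice t, hS.tsupport_glueG_slice_subset t⟩,
    blowupTime T (Real.sqrt (τ / g)), blowupPoint τ z, hT₀,
    not_isRegularPoint_glueG hblock hσ₀ hσ₁ hS.one_lt_gain,
    exists_bound_glueG hblock hσ₀ hσ₁ hS.one_lt_gain.le,
    exists_rate_glueG hblock hσ₀ hσ₁ haσ,
    hS.tendsto_lintegral_norm_sq_glueG, hS.noEnergyAtom_glueG⟩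

end Summit.NavierStokesRegularity.NavierStokesRegularity.Theorems.TypeIliouvilleNoTypeIINegative

end
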